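import Summits.ValiantsHypothesis.ValiantsHypothesis.Theorems.KPlusLogSqLawOctaveNewtonPolygon

/-!
# Route «KPlusLogSqLaw», octave line — coarse envelope geometry: a near-tie of one family of integer-slope lines forces a breakpoint of any two-sided-close coarse family; the near-tie of the true Newton lines at a root; the design envelope is never far below the truth

HONEST FRAMING.  Prover seat val-width-19561-oc1 (g3), `--supports stmt-ValiantsHypothesis-19561` (crux `WeakLifting`, OPEN), octave line of
val-idea-6.  `OctaveWeakLifting` (Ω-W; stmt-ValiantsHypothesis-24457 of the DRAFT sibling route KPlusLogSqLawOctave), `WeakLifting`, `TropicalB`,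
Conjecture B are OPEN and untouched; this file is unconditional elementary geometry of finitely many lines plus Leibniz bookkeeping for
pencil determinants (symmetry unused).  It is the toolbox of the TEMPERED LIFTING file (`…OctaveTempered`).  VP ≠ VNP is not moved.

CONTENT (0 sorry).
* `envelopeBreak_right` — if line `i` is on top at `θ` and a steeper line is at least as high at `θ + D`, the upper envelope breaks (two lines of
  distinct slopes tie at the top) somewhere in `[θ, θ + D]`.
* `coarseEnvelopeGap_right`, `coarseEnvelopeGap` — TWO families `L` (fine) and `G` (coarse) of integer-slope lines: a near-tie (within `c`) of
  `L` at `θ`, `L ≤ G + Wa` everywhere and `top G ≤ top L + Wb` at `θ` force a breakpoint of `G` within `Wa + Wb + c + 1` of `θ`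
  (`envelopeGap` of `…OctaveDepthAtoms` is the case `G = L`).
* `exists_newton_nearTie` — at a nonzero real root of a nonzero real polynomial the top true Newton line is within `log₂ #support` of the Newton
  line of another exponent (isolated from `root_near_newtonBreaks`).
* `exists_rawTerm_of_mem_support` — every exponent of the support of a pencil determinant carries a present raw term of its class with
  `log₂|coeff e| ≤ log₂|rawCoef τ| + log₂ #RawTerm`; `logb_card_rawTerm_le`, `logb_card_support_le` (`≤ M = m(⌊log₂(mK)⌋+1)`).
-/

set_option linter.dupNamespace false
set_option autoImplicit false

namespace Summit.ValiantsHypothesis.ValiantsHypothesis.Theorems.KPlusLogSqLaw.Octave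

open Polynomial Finset
open scoped BigOperators

/-! ### 1. Envelope geometry for two families of integer-slope lines -/

section Envelope

open Finset

/-- **one-sided envelope break.**  Lines `θ ↦ V k + s k · θ` with integer slopes: if line `i` is on top of the family at `θ` and a
STEEPER line `j` is at least as high as `i` at `θ + D`, then the upper envelope has a breakpoint — two lines of distinct slopes tying at the
top — at some `b ∈ [θ, θ + D]` (the first crossing of `i` with a steeper line). [folklore] -/
theorem envelopeBreak_right {ι : Type*} [Fintype ι] (s : ι → ℤ) (V : ι → ℝ) (θ D : ℝ) (i j : ι) (hij : s i < s j)
    (htop : ∀ k, V k + s k * θ ≤ V i + s i * θ) (hover : V i + s i * (θ + D) ≤ V j + s j * (θ + D)) :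
    ∃ b : ℝ, θ ≤ b ∧ b ≤ θ + D ∧ ∃ l, s i ≠ s l ∧ V i + s i * b = V l + s l * b ∧
      ∀ t, V t + s t * b ≤ V i + s i * b := by
  classical
  set R := univ.filter (fun k => s i < s k) with hR
  have hjR : j ∈ R := by simp [hR, hij]
  obtain ⟨k₀, hk₀R, hmin⟩ := Finset.exists_min_image R (fun k => (V i - V k) / ((s k : ℝ) - s i)) ⟨j, hjR⟩
  have hk₀ : s i < s k₀ := (mem_filter.1 hk₀R).2
  have hden : ∀ k, s i < s k → (0 : ℝ) < (s k : ℝ) - s i := fun k hk => by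
    have : (s i : ℝ) < s k := by exact_mod_cast hk
    linarith
  have hcross : ∀ k, s i < s k → θ ≤ (V i - V k) / ((s k : ℝ) - s i) := fun k hk => by
    rw [le_div_iff₀ (hden k hk)]
    have := htop k
    nlinarith
  refine ⟨(V i - V k₀) / ((s k₀ : ℝ) - s i), hcross k₀ hk₀, ?_, k₀, hk₀.ne, ?_, ?_⟩
  · have htj : (V i - V j) / ((s j : ℝ) - s i) ≤ θ + D := by
      rw [div_le_iff₀ (hden j hij)]
      linarith
    exact (hmin j hjR).trans htj
  · have hne : (s k₀ : ℝ) - s i ≠ 0 := (hden k₀ hk₀).ne'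
    have : (V i - V k₀) / ((s k₀ : ℝ) - s i) * ((s k₀ : ℝ) - s i) = V i - V k₀ := div_mul_cancel₀ _ hne
    linarith
  · intro t
    by_cases ht : s i < s t
    · have h1 : (V i - V k₀) / ((s k₀ : ℝ) - s i) ≤ (V i - V t) / ((s t : ℝ) - s i) := hmin t (by simp [hR, ht])
      rw [le_div_iff₀ (hden t ht)] at h1
      linarith
    · push Not at ht
      have hst : (s t : ℝ) ≤ s i := by exact_mod_cast ht
      have hθb : θ ≤ (V i - V k₀) / ((s k₀ : ℝ) - s i) := hcross k₀ hk₀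
      have := htop t
      nlinarith [hst, hθb, this]

/-- **coarse envelope gap, right-moving half.**  Fine family `L = (s, V)`, coarse family `G = (t, U)`, integer slopes.  At `θ`: `i` is
the top of `L`, the `L`-line `k` is within `c` of the top and STEEPER than the top `G`-line `g₀`, and `g₀` is at most `Wb` above the top of
`L`; everywhere: every `L`-line is at most `Wa` below some `G`-line.  Then `G` breaks within `Wa + Wb + c + 1` to the right of `θ`. [folklore] -/
theorem coarseEnvelopeGap_right {ι κ : Type*} [Fintype ι] [Fintype κ] (s : ι → ℤ) (V : ι → ℝ) (t : κ → ℤ) (U : κ → ℝ)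
    (Wa Wb c θ : ℝ) (i k : ι) (g₀ : κ)
    (htop : ∀ l, V l + s l * θ ≤ V i + s i * θ) (hk : V i + s i * θ ≤ V k + s k * θ + c) (hkg : t g₀ < s k)
    (hg₀ : ∀ g, U g + t g * θ ≤ U g₀ + t g₀ * θ) (hbelow : U g₀ + t g₀ * θ ≤ V i + s i * θ + Wb)
    (habove : ∀ φ : ℝ, ∀ l : ι, ∃ g : κ, V l + s l * φ ≤ U g + t g * φ + Wa) :
    ∃ b : ℝ, θ ≤ b ∧ b ≤ θ + (Wa + Wb + c + 1) ∧ ∃ g g' : κ, t g ≠ t g' ∧ U g + t g * b = U g' + t g' * b ∧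
      ∀ h, U h + t h * b ≤ U g + t g * b := by
  set D := Wa + Wb + c + 1 with hD
  -- `D ≥ 1 > 0`
  have hc : 0 ≤ c := by linarith [htop k]
  have hab : 0 ≤ Wa + Wb := by
    obtain ⟨g, hg⟩ := habove θ i
    linarith [hg₀ g]
  have hDpos : 0 < D := by rw [hD]; linarith
  -- at `φ = θ + D` the line `k` is at least `Wa + 1` above `g₀`
  set φ := θ + D with hφ
  have hkg' : (1 : ℝ) ≤ (s k : ℝ) - t g₀ := by
    have h1 : t g₀ + 1 ≤ s k := hkg
    have : ((t g₀ : ℝ)) + 1 ≤ s k := by exact_mod_cast h1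
    linarith
  have hkφ : U g₀ + t g₀ * φ + (Wa + 1) ≤ V k + s k * φ := by
    have h1 : V k + s k * φ = (V k + s k * θ) + s k * D := by rw [hφ]; ring
    have h2 : U g₀ + t g₀ * φ = (U g₀ + t g₀ * θ) + t g₀ * D := by rw [hφ]; ring
    rw [h1, h2]
    have h3 : (s k : ℝ) * D - t g₀ * D ≥ D := by nlinarith [hkg', hDpos]
    linarith
  obtain ⟨g₁, hg₁⟩ := habove φ k
  have hover : U g₀ + t g₀ * φ + 1 ≤ U g₁ + t g₁ * φ := by linarith
  -- hence `g₁` is steeper than `g₀`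
  have ht01 : t g₀ < t g₁ := by
    by_contra hle
    push Not at hle
    have hle' : (t g₁ : ℝ) ≤ t g₀ := by exact_mod_cast hle
    have h1 := hg₀ g₁
    have h2 : U g₁ + t g₁ * φ - (U g₀ + t g₀ * φ) = (U g₁ + t g₁ * θ - (U g₀ + t g₀ * θ)) + (t g₁ - t g₀) * D := by
      rw [hφ]; ring
    have h3 : ((t g₁ : ℝ) - t g₀) * D ≤ 0 := mul_nonpos_of_nonpos_of_nonneg (by linarith) hDpos.le
    linarith
  obtain ⟨b, hθb, hbφ, l, hl, htie, hall⟩ := envelopeBreak_right t U θ D g₀ g₁ ht01 hg₀ (by linarith)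
  exact ⟨b, hθb, hbφ, g₀, l, hl, htie, hall⟩

/-- **coarse envelope gap** (two families of integer-slope lines).  If the fine family `L` has a near-tie at `θ` — its top line `i` is
within `c` of a line `j` of a different slope — and the coarse family `G` satisfies `L ≤ G + Wa` everywhere and `top G ≤ top L + Wb` at
`θ`, then the upper envelope of `G` has a breakpoint within `Wa + Wb + c + 1` of `θ`.  (`envelopeGap` is the case `G = L`, `Wa = Wb = 0`.)
The mechanism of the tempered confinement below: roots force a near-tie of the TRUE Newton lines; the design lines are the coarse family. [folklore] -/
theorem coarseEnvelopeGap {ι κ : Type*} [Fintype ι] [Fintype κ] (s : ι → ℤ) (V : ι → ℝ) (t : κ → ℤ) (U : κ → ℝ)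
    (Wa Wb c θ : ℝ) (i j : ι) (g₀ : κ) (hij : s i ≠ s j)
    (htop : ∀ l, V l + s l * θ ≤ V i + s i * θ) (hnear : V i + s i * θ ≤ V j + s j * θ + c)
    (hg₀ : ∀ g, U g + t g * θ ≤ U g₀ + t g₀ * θ) (hbelow : U g₀ + t g₀ * θ ≤ V i + s i * θ + Wb)
    (habove : ∀ φ : ℝ, ∀ l : ι, ∃ g : κ, V l + s l * φ ≤ U g + t g * φ + Wa) :
    ∃ b : ℝ, |θ - b| ≤ Wa + Wb + c + 1 ∧ ∃ g g' : κ, t g ≠ t g' ∧ U g + t g * b = U g' + t g' * b ∧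
      ∀ h, U h + t h * b ≤ U g + t g * b := by
  have hc : 0 ≤ c := by linarith [htop j]
  -- an `L`-line `k` within `c` of the top whose slope differs from `t g₀`
  obtain ⟨k, hk, hkg⟩ : ∃ k, V i + s i * θ ≤ V k + s k * θ + c ∧ s k ≠ t g₀ := by
    by_cases h : s i = t g₀
    · exact ⟨j, hnear, fun h' => hij (h.trans h'.symm)⟩
    · exact ⟨i, by linarith, h⟩
  rcases lt_or_gt_of_ne hkg with hlt | hgt
  · -- `k` is LESS steep than `g₀`: reflect `θ ↦ -θ`
    obtain ⟨b, hθb, hbD, g, g', hgg', htie, hall⟩ := coarseEnvelopeGap_right (fun l => -s l) V (fun g => -t g) U Wa Wb c (-θ)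
      i k g₀ (fun l => by have := htop l; push_cast; linarith) (by push_cast; linarith) (by simpa using hlt)
      (fun g => by have := hg₀ g; push_cast; linarith) (by push_cast; linarith)
      (fun φ l => by
        obtain ⟨g, hg⟩ := habove (-φ) l
        exact ⟨g, by push_cast; linarith⟩)
    refine ⟨-b, ?_, g, g', ?_, ?_, ?_⟩
    · rw [show θ - -b = -(-θ - b) by ring, abs_neg, abs_of_nonpos (by linarith)]
      linarith
    · simpa using hgg'
    · push_cast at htie
      linarith
    · intro h
      have := hall h
      push_cast at this
      linarith
  · obtain ⟨b, hθb, hbD, g, g', hgg', htie, hall⟩ := coarseEnvelopeGap_right s V t U Wa Wb c θ i k g₀ htop hk hgt hg₀ hbelow habove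
    refine ⟨b, ?_, g, g', hgg', htie, hall⟩
    rw [abs_of_nonpos (by linarith)]
    linarith

end Envelope

/-! ### 2. The near-tie at a root and the raw/Newton comparison -/

section NearTie

open Finset

/-- **near-tie of the true Newton lines at a root.**  At a nonzero real root `x` of a nonzero real polynomial `p`, with `θ = log₂|x|`,
the top Newton line `e₀` (maximising `log₂|coeff e| + e θ` over the support) is within `log₂ #support` of the Newton line of another
exponent `e₁` (the top term is cancelled by the others, hence at most `#support − 1` times the runner-up). [folklore] -/
theorem exists_newton_nearTie (p : ℝ[X]) (x : ℝ) (hx0 : x ≠ 0) (hp : p ≠ 0) (hroot : p.IsRoot x) :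
    ∃ e₀ ∈ p.support, ∃ e₁ ∈ p.support, e₀ ≠ e₁ ∧
      (∀ e ∈ p.support, newtonLog p e + e * Real.logb 2 |x| ≤ newtonLog p e₀ + e₀ * Real.logb 2 |x|) ∧
      newtonLog p e₀ + e₀ * Real.logb 2 |x| ≤ newtonLog p e₁ + e₁ * Real.logb 2 |x| + Real.logb 2 p.support.card := by
  classical
  set y := |x| with hy_def
  have hy : 0 < y := abs_pos.2 hx0
  have hyne : y ≠ 0 := hy.ne'
  set u := x / |x| with hu_def
  have hu : u = 1 ∨ u = -1 := sign_div_abs x hx0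
  have huy : u * y = x := by rw [hu_def, hy_def]; exact div_mul_cancel₀ x (abs_ne_zero.2 hx0)
  have hupow : ∀ n : ℕ, u ^ n = 1 ∨ u ^ n = -1 := fun n => by
    rcases hu with h | h
    · left; simp [h]
    · rw [h]; exact neg_one_pow_eq_or ℝ n
  let ι := {e : ℕ // e ∈ p.support}
  have hcoef : ∀ e : ι, p.coeff e.1 ≠ 0 := fun e => Polynomial.mem_support_iff.1 e.2
  let a : ι → ℝ := fun e => |p.coeff e.1|
  let sg : ι → ℝ := fun e => p.coeff e.1 / |p.coeff e.1| * u ^ e.1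
  have hapos : ∀ e, 0 < a e := fun e => abs_pos.2 (hcoef e)
  have ha : ∀ e, 0 ≤ a e := fun e => (hapos e).le
  have hsg : ∀ e, sg e = 1 ∨ sg e = -1 := fun e => by
    simp only [sg]
    rcases sign_div_abs _ (hcoef e) with h1 | h1 <;> rcases hupow e.1 with h2 | h2 <;> simp [h1, h2]
  have hF1 : ∀ e, sg e * a e = p.coeff e.1 * u ^ e.1 := fun e => by
    have hne : |p.coeff e.1| ≠ 0 := abs_ne_zero.2 (hcoef e)
    show p.coeff e.1 / |p.coeff e.1| * u ^ e.1 * |p.coeff e.1| = p.coeff e.1 * u ^ e.1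
    rw [mul_assoc, mul_comm (u ^ e.1), ← mul_assoc, div_mul_cancel₀ _ hne]
  have hF2 : ∀ e, sg e * a e * y ^ e.1 = p.coeff e.1 * x ^ e.1 := fun e => by
    rw [hF1, mul_assoc, ← mul_pow, huy]
  have heval : p.eval x = ∑ e ∈ p.support, p.coeff e * x ^ e := by
    rw [Polynomial.eval_eq_sum, Polynomial.sum_def]
  have hroot' : ∑ e : ι, sg e * a e * y ^ e.1 = 0 := by
    simp_rw [hF2]
    rw [Finset.sum_coe_sort p.support (fun e => p.coeff e * x ^ e), ← heval]
    exact hroot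
  obtain ⟨e₁, he₁⟩ : p.support.Nonempty := Polynomial.support_nonempty.2 hp
  obtain ⟨τ₀, -, hmax⟩ := Finset.exists_max_image (univ : Finset ι) (fun e => a e * y ^ e.1) ⟨⟨e₁, he₁⟩, mem_univ _⟩
  have hclass : univ.filter (fun e : ι => e.1 = τ₀.1) = {τ₀} := by
    ext e
    simp only [mem_filter, mem_univ, true_and, mem_singleton]
    exact Subtype.ext_iff.symm
  have hdepth : (∑ e ∈ univ.filter (fun e : ι => e.1 = τ₀.1), a e) ≤
      (2 : ℝ) ^ (0 : ℕ) * |∑ e ∈ univ.filter (fun e : ι => e.1 = τ₀.1), sg e * a e| := by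
    rw [hclass, sum_singleton, sum_singleton, pow_zero, one_mul, abs_mul, abs_of_pos (hapos τ₀)]
    have : |sg τ₀| = 1 := by rcases hsg τ₀ with h | h <;> simp [h]
    rw [this, one_mul]
  obtain ⟨τ₁, hs₁, hconf⟩ := rawConfinement_oneClass (fun e : ι => e.1) a ha sg hsg 0 y hy hroot' τ₀ (hapos τ₀) hdepth
  rw [pow_zero, mul_one] at hconf
  set N := Fintype.card ι with hN
  have hNcard : N = p.support.card := by rw [hN]; exact Fintype.card_coe p.support
  have hNpos : 0 < (N : ℝ) := by
    have : 0 < N := Fintype.card_pos_iff.2 ⟨τ₀⟩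
    exact_mod_cast this
  set θ := Real.logb 2 y with hθ
  have hlog_line : ∀ e : ι, Real.logb 2 (a e * y ^ e.1) = newtonLog p e.1 + (e.1 : ℝ) * θ := by
    intro e
    rw [Real.logb_mul (hapos e).ne' (pow_ne_zero _ hyne), Real.logb_pow, newtonLog]
  refine ⟨τ₀.1, τ₀.2, τ₁.1, τ₁.2, fun h => hs₁ h.symm, fun e he => ?_, ?_⟩
  · rw [← hlog_line ⟨e, he⟩, ← hlog_line τ₀]
    exact Real.logb_le_logb_of_le (by norm_num) (mul_pos (hapos ⟨e, he⟩) (pow_pos hy _)) (hmax ⟨e, he⟩ (mem_univ _))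
  · rw [← hNcard, ← hlog_line τ₀, ← hlog_line τ₁]
    have h1 := Real.logb_le_logb_of_le (b := 2) (by norm_num) (mul_pos (hapos τ₀) (pow_pos hy _)) hconf
    have h2 : Real.logb 2 (N * (a τ₁ * y ^ τ₁.1)) = Real.logb 2 N + Real.logb 2 (a τ₁ * y ^ τ₁.1) :=
      Real.logb_mul hNpos.ne' (mul_pos (hapos τ₁) (pow_pos hy _)).ne'
    linarith

variable {m K : ℕ}

/-- **the design envelope is never far below the truth.**  Every exponent `e` in the support of a pencil determinant carries a present
raw term `τ` of slope class `e` with `log₂|coeff e| ≤ log₂|rawCoef τ| + log₂ #RawTerm` (a coefficient is the signed sum of at most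
`#RawTerm` raw terms of its class). [folklore] -/
theorem exists_rawTerm_of_mem_support (d : Fin K → ℕ) (S : Fin K → Matrix (Fin m) (Fin m) ℝ) {e : ℕ}
    (he : e ∈ (pencilDet d S).support) :
    ∃ τ : RawTerm m K, rawCoef S τ ≠ 0 ∧ rawSlope d τ = e ∧
      newtonLog (pencilDet d S) e ≤ rawLog S τ + Real.logb 2 (Fintype.card (RawTerm m K)) := by
  classical
  have hce : (pencilDet d S).coeff e ≠ 0 := Polynomial.mem_support_iff.1 he
  set C := univ.filter (fun τ : RawTerm m K => rawSlope d τ = e) with hC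
  have hsum : (pencilDet d S).coeff e = ∑ τ ∈ C, rawCoef S τ := coeff_pencilDet_eq_sum d S e
  obtain ⟨τp, hτpC, hτp⟩ : ∃ τ ∈ C, rawCoef S τ ≠ 0 := by
    rw [hsum] at hce
    exact Finset.exists_ne_zero_of_sum_ne_zero hce
  obtain ⟨τ, hτC, hmax⟩ := Finset.exists_max_image C (fun τ => |rawCoef S τ|) ⟨τp, hτpC⟩
  have hτpos : 0 < |rawCoef S τ| := (abs_pos.2 hτp).trans_le (hmax τp hτpC)
  have hτ : rawCoef S τ ≠ 0 := abs_pos.1 hτpos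
  set N := Fintype.card (RawTerm m K) with hN
  have hNpos : 0 < (N : ℝ) := by
    have : 0 < N := Fintype.card_pos_iff.2 ⟨τ⟩
    exact_mod_cast this
  have hcard : (C.card : ℝ) ≤ N := by
    have : C.card ≤ N := (card_filter_le _ _).trans (Finset.card_univ).le
    exact_mod_cast this
  have hbound : |(pencilDet d S).coeff e| ≤ N * |rawCoef S τ| :=
    calc |(pencilDet d S).coeff e| = |∑ τ' ∈ C, rawCoef S τ'| := by rw [hsum]
      _ ≤ ∑ τ' ∈ C, |rawCoef S τ'| := abs_sum_le_sum_abs _ _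
      _ ≤ ∑ _τ' ∈ C, |rawCoef S τ| := Finset.sum_le_sum fun τ' hτ' => hmax τ' hτ'
      _ = C.card * |rawCoef S τ| := by rw [Finset.sum_const, nsmul_eq_mul]
      _ ≤ N * |rawCoef S τ| := mul_le_mul_of_nonneg_right hcard hτpos.le
  refine ⟨τ, hτ, (mem_filter.1 hτC).2, ?_⟩
  have h1 := Real.logb_le_logb_of_le (b := 2) (by norm_num) (abs_pos.2 hce) hbound
  rw [Real.logb_mul hNpos.ne' hτpos.ne'] at h1
  rw [newtonLog, rawLog]
  linarith

/-- `log₂ #RawTerm ≤ M = m(⌊log₂(mK)⌋+1)`. [folklore] -/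
theorem logb_card_rawTerm_le (m K : ℕ) (hpos : 0 < Fintype.card (RawTerm m K)) :
    Real.logb 2 (Fintype.card (RawTerm m K)) ≤ ((m * (Nat.log 2 (m * K) + 1) : ℕ) : ℝ) := by
  have hc := card_rawTerm_le m K
  have hNpos : 0 < ((Fintype.card (RawTerm m K) : ℕ) : ℝ) := by exact_mod_cast hpos
  have h1 : ((Fintype.card (RawTerm m K) : ℕ) : ℝ) ≤ (2 : ℝ) ^ (m * (Nat.log 2 (m * K) + 1)) := by exact_mod_cast hc
  have h2 := Real.logb_le_logb_of_le (b := 2) (by norm_num) hNpos h1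
  rw [Real.logb_pow, Real.logb_self_eq_one (by norm_num), mul_one] at h2
  exact h2

/-- `log₂ #support(pencilDet) ≤ M`. [folklore] -/
theorem logb_card_support_le (d : Fin K → ℕ) (S : Fin K → Matrix (Fin m) (Fin m) ℝ) (hpos : 0 < (pencilDet d S).support.card) :
    Real.logb 2 (pencilDet d S).support.card ≤ ((m * (Nat.log 2 (m * K) + 1) : ℕ) : ℝ) := by
  have hc := card_support_pencilDet_le d S
  have hNpos : 0 < (((pencilDet d S).support.card : ℕ) : ℝ) := by exact_mod_cast hpos
  have h1 : (((pencilDet d S).support.card : ℕ) : ℝ) ≤ (2 : ℝ) ^ (m * (Nat.log 2 (m * K) + 1)) := by exact_mod_cast hc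
  have h2 := Real.logb_le_logb_of_le (b := 2) (by norm_num) hNpos h1
  rw [Real.logb_pow, Real.logb_self_eq_one (by norm_num), mul_one] at h2
  exact h2

end NearTie

end Summit.ValiantsHypothesis.ValiantsHypothesis.Theorems.KPlusLogSqLaw.Octave
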